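import Summits.QuantumFields.BalabanUV.Beta.GAN24.CarrierSlotLegBottomKernel
import Summits.QuantumFields.BalabanUV.Beta.GAN24.DressedSlotLegSplit
import Summits.QuantumFields.BalabanUV.Beta.GAN24.StaircaseFaces

/-!
# `BalabanUV.Beta.GAN24.CarrierSlotLegBottomKernelRate` — binder row G-an2-4 ∕ (CONV-C), W-slot, the (α-0) parity re-cut, located crux (Q-L-k₀), the DRIFT rows
# (leaf-03 g68 FILE 4 ∕ FILE 5 `HΔw`; OWNER `b2b-balaban-gan24-p1` gen 38, part 8b′ — THE RATE ORDER):
# **THE COMPOSITE SLOT LEGS OF THE SWAPPED FAMILY HAVE ONE BLOCK-LABEL RATE FOR EVERY LENGTH** — `∃ κ₈ > 0, ∀ q, ∃ a₈ ≥ 0, …`: for the family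
# `K′ := update K♮ᴱ p M` (`Decays M CM δM`), `|legChain (colH ∘ K′) p q μ y κ v| ≤ CM·a₈·e^{−κ₈‖quo (Lc^{q+1}) v − y‖∞}` with `κ₈` chosen BEFORE the length `q`.

NOT IN PRINT; OUR BOOKKEEPING ([folklore] re-indexing BY NAME: MY part 5 `DressedSlotLegSplit` (p371270 ✓) for the chain ABOVE the bottom level — it is the NATURAL
composite slot leg `respStep + d_z(Ψ − bm gauge)` whose block-label rate `κb` does not depend on the length —, ONE composition with `colH M` in block-label
currency (a two-rate sum in the style of leaf-03's `Push4TwoRate`, written for `‖quo · − ·‖∞` and the coarse dilation `u ↦ Lc•v`), MY part 8b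
`CarrierSlotLegBottomKernel` (p370784) for `legChain_congr_from` ∕ `legDecay_colH_update` ∕ the `q = 0` conversion; 0 `def`, 0 cited facts, 0 `def … : Prop`, 0 sorry).
HONEST FRAMING (cell contract, verbatim): «discharging `BetaPertH` makes Bałaban's UV stability UNCONDITIONAL — a real constructive-QFT result; it is NOT the continuum
limit and NOT the Clay problem.»  HONEST DEPENDENCY (verbatim): «continuum YM on T⁴ ⇐ BetaPertH ∧ nine spine estimates (0/9 proved); BetaPertH ⇐ (D1) ∧ (D4) ∧ CAP+tail;
G-an2-4 gates asym, D1 and NE2/3/4.»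

WHY (the rate ORDER, journal INFO [GAN24P1-G38-ONLINE]): leaf-03's FILE 5 fixes the rates `(δ, δS, δD)` BEFORE `k₀` and asks the drift tower's contraction `H1D` at `(k₀, δD)`,
so `k₀ ≥ kmin(δD)` (MY part 6 at rate `δD`); the drift windows `HΔw` read the legs at rate `18(d+1)·δD`, hence the legs' rate ceiling must not depend on the window length
`q < k₀`.  Part 8b's `exists_dressed_slotLeg_bottomKernel_envelopes` is stated `(q) : ∃ a₈ κ₈` (true; its `κ₈(q)` is a site-currency rate shrinking geometrically in `q`);
this file supplies the `∃ κ₈ ∀ q` form the window assembly (MY part 12 `NaturalWindowDrift`) consumes.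

WHAT:
* §1 (generic `d`, `1 ≤ Lc`) block geometry one level up: `‖quo(Lc^{k+2}) u − y‖∞ ≤ ‖quo(Lc^{k+1}) v − y‖∞ + |u − Lc•v|₁` (`quo_quo` ∕ `quo_zsmul` + `supNorm_quo_sub_quo_le_l1`),
  `|quo Lc u − v|₁ ≤ |u − Lc•v|₁`; the two-rate pointwise bound and **`tsum_two_rate_blk_le`**:
  `Σ'_v e^{−m‖quo(Lc^{k+1}) v − y‖∞}·e^{−δ|u − Lc•v|₁} ≤ Zl(δ∕2)·e^{−min(m, δ∕2)·‖quo(Lc^{k+2}) u − y‖∞}`.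
* §2 (generic `d`) **`abs_legComp_colH_le`** — a leg family with a block-label envelope at blocking `Lc^{k+1}`, composed below with `colH M Lc` of a decaying `M`:
  `|legComp (colH M Lc) U μ y κ u| ≤ (d+1)·A·CM·Zl(δM∕2)·e^{−min(m, δM∕2)‖quo(Lc^{k+2}) u − y‖∞}`; `abs_sub_le_of_env` (the crude unit gradient from a sup envelope).
* §3 (`d = 3`, `2 ≤ Lc`) **`exists_dressed_slotLeg_bottomKernel_envelopes_rate`** (as displayed): `κ₈ := min κb (δM∕2)` from part 5's `κb`; for `q = k+1` the chain is
  `legComp (colH M Lc) (legChain (colH ∘ K♮ᴱ) (p+1) k)` (`legChain_succ_left` ⨾ `legChain_congr_from`), the upper chain = `respStep (Lc^{p+1}) (Lc^{p+k+2}) + d_z(…)` by part 5's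
  `legChain_dressed_colH_eq` with envelope `(Cr + Cφ·(e^{κb}+1))·e^{−κb‖quo(Lc^{k+1}) v − y‖∞}` (`exists_dressed_slotLeg_envelopes`, the powers of `Lc` dropped); `q = 0` is `colH M`
  alone (part 8b's `abs_le_env_of_legDecay`, rate `δM ≥ κ₈`).
Asserts NOTHING about Bałaban's tables; NOT (H1Δw); NOTHING of (Q-L) ∕ (C)sym discharged; NEVER «G-an2-4 closed» as (CONV-C); NOT D1, NOT `BetaPertH`, NOT continuum, NOT
Clay; not in print.  Unit `b2b-balaban-gan24-p1` (BINDER row G-an2-4 OWNER; CRUX PROVER on C-R8° CT-ROUTE), gen 38, 2026-08-23.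
-/

noncomputable section

open Finset
open scoped BigOperators
open Literature.MathematicalPhysics.QuantumFieldTheory
open Literature.MathematicalPhysics.QuantumFieldTheory.LatticeForm (quo)
open Literature.MathematicalPhysics.QuantumFieldTheory.Balaban1983to89
open Literature.MathematicalPhysics.QuantumFieldTheory.Balaban1983to89.Beta
open B4ContourShift (supNorm supNorm_nonneg)
open B4Reflection242 (supNorm_add_le)
open B6BondElimination (unitVec)
open B12Sec2to5 (l1 l1_nonneg)
open ExpKernelCalculus (MKer Decays Zl Zl_nonneg Zl_pos l1_sub_symm l1_sub_triangle tsum_exp_shift summable_exp_shift)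
open OneStepResolventKernel (Fib quo_zsmul)
open OneStepKernelFamily (KInvStep colH)
open AffineAveraging (Site box toSite)
open BalabanCompositeJets (respStep)
open Summit.QuantumFields.BalabanUV.Beta.HessKerDressedUnits (unitK)
open Summit.QuantumFields.BalabanUV.Beta.AxialDressingRooted (coDressKBmAt)
open Summit.QuantumFields.BalabanUV.Beta.AxialProjectorBlockMean (bmGaugeAt)
open Summit.QuantumFields.BalabanUV.Beta.GAN24.CombesThomas (sfStep smStep)
open Summit.QuantumFields.BalabanUV.Beta.GAN24.Push4 (legComp legComp_apply)
open Summit.QuantumFields.BalabanUV.Beta.GAN24.Push4Bounds (LegDecay legDecay_colH)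
open Summit.QuantumFields.BalabanUV.Beta.GAN24.Push4Iter (LegFam legChain legChain_zero)
open Summit.QuantumFields.BalabanUV.Beta.GAN24.LegCompAssoc (legChain_succ_left)
open Summit.QuantumFields.BalabanUV.Beta.GAN24.EnvelopeBlockSum (supNorm_quo_sub_quo_le_l1 supNorm_quo_sub_le_add_l1 env_wobble)
open Summit.QuantumFields.BalabanUV.Beta.GAN24.Push4TwoRate (l1_quo_sub_quo_le_l1)
open Summit.QuantumFields.BalabanUV.Beta.GAN24.StaircaseFaces (quo_quo)
open Summit.QuantumFields.BalabanUV.Beta.GAN24.RespStepBmDecompLegs (legAct)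
open Summit.QuantumFields.BalabanUV.Beta.GAN24.RespStepBmDecompPsi (Psi)
open Summit.QuantumFields.BalabanUV.Beta.GAN24.DressedStepDifferenceRows (exists_dressedStep_rows)
open Summit.QuantumFields.BalabanUV.Beta.GAN24.DressedSlotLegSplit (legChain_dressed_colH_eq exists_dressed_slotLeg_envelopes)
open Summit.QuantumFields.BalabanUV.Beta.GAN24.CarrierSlotLegBottomKernel (legChain_congr_from legDecay_colH_update abs_le_env_of_legDecay)

namespace Summit.QuantumFields.BalabanUV.Beta.GAN24.CarrierSlotLegBottomKernelRate

/-! ## §1 Block geometry one level up; the two-rate sum in block-label currency -/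

section Generic

variable {d : ℕ} {Lc : ℕ}

/-- [folklore] One level up the block label moves by at most the fine `ℓ¹` offset: `‖quo(Lc^{k+2}) u − y‖∞ ≤ ‖quo(Lc^{k+1}) v − y‖∞ + |u − Lc•v|₁`. -/
theorem supNorm_quo_succ_le (hLc : 1 ≤ Lc) (k : ℕ) (u v y : Site (d + 1)) :
    supNorm (quo (Lc ^ (k + 2)) u - y) ≤ supNorm (quo (Lc ^ (k + 1)) v - y) + l1 (u - (Lc : ℤ) • v) := by
  haveI : NeZero Lc := ⟨by omega⟩
  have hLk : 1 ≤ Lc ^ (k + 2) := Nat.one_le_pow _ _ hLc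
  have h1 : supNorm (quo (Lc ^ (k + 2)) u - quo (Lc ^ (k + 2)) ((Lc : ℤ) • v)) ≤ l1 (u - (Lc : ℤ) • v) :=
    supNorm_quo_sub_quo_le_l1 hLk u ((Lc : ℤ) • v)
  have hq : quo (Lc ^ (k + 2)) ((Lc : ℤ) • v) = quo (Lc ^ (k + 1)) v := by
    have h := quo_quo (d := d) Lc (Lc ^ (k + 1)) ((Lc : ℤ) • v)
    rw [quo_zsmul] at h
    rw [h, show Lc * Lc ^ (k + 1) = Lc ^ (k + 2) by ring]
  rw [hq] at h1
  have h2 := supNorm_add_le (quo (Lc ^ (k + 1)) v - y) (quo (Lc ^ (k + 2)) u - quo (Lc ^ (k + 1)) v)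
  rw [show quo (Lc ^ (k + 1)) v - y + (quo (Lc ^ (k + 2)) u - quo (Lc ^ (k + 1)) v) = quo (Lc ^ (k + 2)) u - y by abel] at h2
  linarith

/-- [folklore] The block label of the fine point is `ℓ¹`-close to the coarse point: `|quo Lc u − v|₁ ≤ |u − Lc•v|₁`. -/
theorem l1_quo_sub_le (hLc : 1 ≤ Lc) (u v : Site (d + 1)) : l1 (quo Lc u - v) ≤ l1 (u - (Lc : ℤ) • v) := by
  haveI : NeZero Lc := ⟨by omega⟩
  have h := l1_quo_sub_quo_le_l1 hLc u ((Lc : ℤ) • v)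
  rwa [quo_zsmul] at h

/-- [folklore] **TWO-RATE POINTWISE BOUND, BLOCK-LABEL CURRENCY**: with `η := min m (δ∕2)`,
`e^{−m‖quo(Lc^{k+1}) v − y‖∞}·e^{−δ|u − Lc•v|₁} ≤ e^{−(δ∕2)|quo Lc u − v|₁}·e^{−η‖quo(Lc^{k+2}) u − y‖∞}`. -/
theorem exp_two_rate_blk_le (hLc : 1 ≤ Lc) (k : ℕ) {m δ : ℝ} (hm : 0 ≤ m) (hδ : 0 ≤ δ) (u v y : Site (d + 1)) :
    Real.exp (-(m * supNorm (quo (Lc ^ (k + 1)) v - y))) * Real.exp (-δ * l1 (u - (Lc : ℤ) • v))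
      ≤ Real.exp (-(δ / 2) * l1 (quo Lc u - v)) * Real.exp (-(min m (δ / 2) * supNorm (quo (Lc ^ (k + 2)) u - y))) := by
  rw [← Real.exp_add, ← Real.exp_add, Real.exp_le_exp]
  have hA := supNorm_quo_succ_le hLc k u v y
  have hB := l1_quo_sub_le hLc u v
  have hη1 : min m (δ / 2) ≤ m := min_le_left _ _
  have hη2 : min m (δ / 2) ≤ δ / 2 := min_le_right _ _
  have hη0 : 0 ≤ min m (δ / 2) := le_min hm (by linarith)
  have h1 := supNorm_nonneg (quo (Lc ^ (k + 1)) v - y)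
  have h2 := l1_nonneg (u - (Lc : ℤ) • v)
  have h3 := l1_nonneg (quo Lc u - v)
  nlinarith [mul_le_mul_of_nonneg_left hA hη0, mul_le_mul_of_nonneg_right hη1 h1, mul_le_mul_of_nonneg_right hη2 h2,
    mul_le_mul_of_nonneg_left hB (by linarith : (0 : ℝ) ≤ δ / 2)]

/-- [folklore] The two-rate summand is summable (dominated through `|quo Lc u − v|₁ ≤ |u − Lc•v|₁`). -/
theorem summable_two_rate_blk (hLc : 1 ≤ Lc) (k : ℕ) {m δ : ℝ} (hm : 0 ≤ m) (hδ : 0 < δ) (u y : Site (d + 1)) :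
    Summable fun v : Site (d + 1) =>
      Real.exp (-(m * supNorm (quo (Lc ^ (k + 1)) v - y))) * Real.exp (-δ * l1 (u - (Lc : ℤ) • v)) := by
  refine Summable.of_nonneg_of_le (fun v => by positivity) (fun v => ?_) (summable_exp_shift hδ (quo Lc u))
  have h1 : Real.exp (-(m * supNorm (quo (Lc ^ (k + 1)) v - y))) ≤ 1 :=
    Real.exp_le_one_iff.2 (by nlinarith [supNorm_nonneg (quo (Lc ^ (k + 1)) v - y)])
  have h2 : Real.exp (-δ * l1 (u - (Lc : ℤ) • v)) ≤ Real.exp (-δ * l1 (quo Lc u - v)) := by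
    rw [Real.exp_le_exp]; have := l1_quo_sub_le hLc u v; nlinarith
  calc Real.exp (-(m * supNorm (quo (Lc ^ (k + 1)) v - y))) * Real.exp (-δ * l1 (u - (Lc : ℤ) • v))
      ≤ 1 * Real.exp (-δ * l1 (quo Lc u - v)) := mul_le_mul h1 h2 (Real.exp_pos _).le zero_le_one
    _ = _ := one_mul _

/-- [folklore] **THE TWO-RATE SUM, BLOCK-LABEL CURRENCY**: `Σ'_v e^{−m‖quo(Lc^{k+1}) v − y‖∞}·e^{−δ|u − Lc•v|₁} ≤ Zl(δ∕2)·e^{−min(m,δ∕2)‖quo(Lc^{k+2}) u − y‖∞}` — the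
`v`-sum is paid by HALF the kernel's fine decay (`tsum_exp_shift` at the block label `quo Lc u`); the constant is free of `Lc`, `k` and `m`. -/
theorem tsum_two_rate_blk_le (hLc : 1 ≤ Lc) (k : ℕ) {m δ : ℝ} (hm : 0 ≤ m) (hδ : 0 < δ) (u y : Site (d + 1)) :
    ∑' v : Site (d + 1), Real.exp (-(m * supNorm (quo (Lc ^ (k + 1)) v - y))) * Real.exp (-δ * l1 (u - (Lc : ℤ) • v))
      ≤ Zl (d + 1) (δ / 2) * Real.exp (-(min m (δ / 2) * supNorm (quo (Lc ^ (k + 2)) u - y))) := by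
  have hδ2 : 0 < δ / 2 := by linarith
  calc ∑' v : Site (d + 1), Real.exp (-(m * supNorm (quo (Lc ^ (k + 1)) v - y))) * Real.exp (-δ * l1 (u - (Lc : ℤ) • v))
      ≤ ∑' v : Site (d + 1), Real.exp (-(δ / 2) * l1 (quo Lc u - v)) * Real.exp (-(min m (δ / 2) * supNorm (quo (Lc ^ (k + 2)) u - y))) :=
        Summable.tsum_le_tsum (fun v => exp_two_rate_blk_le hLc k hm hδ.le u v y) (summable_two_rate_blk hLc k hm hδ u y)
          ((summable_exp_shift hδ2 (quo Lc u)).mul_right _)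
    _ = Zl (d + 1) (δ / 2) * Real.exp (-(min m (δ / 2) * supNorm (quo (Lc ^ (k + 2)) u - y))) := by
        rw [tsum_mul_right, tsum_exp_shift]

/-! ## §2 A block-label leg composed below with the `ℋ`-column of a decaying kernel -/

/-- [folklore] **LEG AGAINST KERNEL IN BLOCK-LABEL CURRENCY**: if `|F v λ| ≤ A·e^{−m‖quo(Lc^{k+1}) v − y‖∞}·B·e^{−δ|u − Lc•v|₁}` then
`|Σ'_v Σ_λ F v λ| ≤ (d+1)·A·B·Zl(δ∕2)·e^{−min(m,δ∕2)‖quo(Lc^{k+2}) u − y‖∞}`. -/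
theorem abs_tsum_sum_le_of_two_rate (hLc : 1 ≤ Lc) (k : ℕ) {m δ A B : ℝ} (hm : 0 ≤ m) (hδ : 0 < δ) (hA : 0 ≤ A) (hB : 0 ≤ B)
    (u y : Site (d + 1)) {F : Site (d + 1) → Fin (d + 1) → ℝ}
    (hF : ∀ v lam, |F v lam| ≤ A * Real.exp (-(m * supNorm (quo (Lc ^ (k + 1)) v - y))) * (B * Real.exp (-δ * l1 (u - (Lc : ℤ) • v)))) :
    |∑' v, ∑ lam, F v lam|
      ≤ ((d + 1 : ℕ) : ℝ) * A * B * Zl (d + 1) (δ / 2) * Real.exp (-(min m (δ / 2) * supNorm (quo (Lc ^ (k + 2)) u - y))) := by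
  have hpt : ∀ v, |∑ lam, F v lam| ≤ ((d + 1 : ℕ) : ℝ) * A * B *
      (Real.exp (-(m * supNorm (quo (Lc ^ (k + 1)) v - y))) * Real.exp (-δ * l1 (u - (Lc : ℤ) • v))) := by
    intro v
    calc |∑ lam, F v lam| ≤ ∑ lam, |F v lam| := Finset.abs_sum_le_sum_abs _ _
      _ ≤ ∑ _lam : Fin (d + 1), A * Real.exp (-(m * supNorm (quo (Lc ^ (k + 1)) v - y))) * (B * Real.exp (-δ * l1 (u - (Lc : ℤ) • v))) :=
          Finset.sum_le_sum fun lam _ => hF v lam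
      _ = _ := by rw [Finset.sum_const, Finset.card_univ, Fintype.card_fin, nsmul_eq_mul]; ring
  have hs := (summable_two_rate_blk hLc k hm hδ u y).mul_left (((d + 1 : ℕ) : ℝ) * A * B)
  have hb := tsum_of_norm_bounded hs.hasSum (fun v => by rw [Real.norm_eq_abs]; exact hpt v)
  rw [Real.norm_eq_abs] at hb
  refine hb.trans ?_
  rw [tsum_mul_left]
  have h := tsum_two_rate_blk_le hLc k hm hδ u y
  calc ((d + 1 : ℕ) : ℝ) * A * B * ∑' v : Site (d + 1), Real.exp (-(m * supNorm (quo (Lc ^ (k + 1)) v - y))) * Real.exp (-δ * l1 (u - (Lc : ℤ) • v))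
      ≤ ((d + 1 : ℕ) : ℝ) * A * B * (Zl (d + 1) (δ / 2) * Real.exp (-(min m (δ / 2) * supNorm (quo (Lc ^ (k + 2)) u - y)))) :=
        mul_le_mul_of_nonneg_left h (by positivity)
    _ = _ := by ring

/-- [folklore] **A BLOCK-LABEL LEG COMPOSED BELOW WITH THE `ℋ`-COLUMN OF A DECAYING KERNEL KEEPS A BLOCK-LABEL ENVELOPE ONE LEVEL DOWN**, rate `min(m, δM∕2)`,
constant linear in `CM`: `|legComp (colH M Lc) U μ y κ u| ≤ (d+1)·A·CM·Zl(δM∕2)·e^{−min(m,δM∕2)‖quo(Lc^{k+2}) u − y‖∞}`. -/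
theorem abs_legComp_colH_le (hLc : 1 ≤ Lc) (k : ℕ) {U : LegFam d} {A m : ℝ} (hA : 0 ≤ A) (hm : 0 ≤ m)
    (hU : ∀ μ y lam v, |U μ y lam v| ≤ A * Real.exp (-(m * supNorm (quo (Lc ^ (k + 1)) v - y))))
    {M : MKer (d + 1) (Fib d)} {CM δM : ℝ} (hCM : 0 ≤ CM) (hδM : 0 < δM) (hM : Decays M CM δM)
    (μ : Fin (d + 1)) (y : Site (d + 1)) (κ : Fin (d + 1)) (u : Site (d + 1)) :
    |legComp (colH M Lc) U μ y κ u|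
      ≤ ((d + 1 : ℕ) : ℝ) * A * CM * Zl (d + 1) (δM / 2) * Real.exp (-(min m (δM / 2) * supNorm (quo (Lc ^ (k + 2)) u - y))) := by
  rw [legComp_apply]
  refine abs_tsum_sum_le_of_two_rate hLc k hm hδM hA hCM u y (fun v lam => ?_)
  rw [abs_mul]
  exact mul_le_mul (hU μ y lam v) (legDecay_colH (N := Lc) hM lam v κ u) (abs_nonneg _) (by positivity)

/-- [folklore] **THE CRUDE UNIT GRADIENT FROM A SUP ENVELOPE**: `|R u| ≤ C·e^{−η‖quo L u − y‖∞}` for all `u` (`η ≥ 0`, `L ≥ 1`) ⟹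
`|R (u + e_i) − R u| ≤ C·(e^{η}+1)·e^{−η‖quo L u − y‖∞}` (the shifted point's block label moves by at most one). -/
theorem abs_sub_le_of_env {L : ℕ} (hL : 1 ≤ L) {R : Site (d + 1) → ℝ} {C η : ℝ} (hC : 0 ≤ C) (hη : 0 ≤ η) (y : Site (d + 1))
    (h : ∀ u, |R u| ≤ C * Real.exp (-(η * supNorm (quo L u - y)))) (u : Site (d + 1)) (i : Fin (d + 1)) :
    |R (u + Pi.single i 1) - R u| ≤ C * (Real.exp η + 1) * Real.exp (-(η * supNorm (quo L u - y))) := by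
  have hl1 : l1 (u + Pi.single i 1 - u) = 1 := by
    rw [add_sub_cancel_left]
    unfold l1
    rw [Finset.sum_eq_single i (fun j _ hj => by simp [hj]) (fun hh => (hh (Finset.mem_univ i)).elim)]
    simp
  have hw := env_wobble (d := d) hL hη y u (u + Pi.single i 1)
  rw [hl1, mul_one] at hw
  calc |R (u + Pi.single i 1) - R u| ≤ |R (u + Pi.single i 1)| + |R u| := abs_sub _ _
    _ ≤ C * (Real.exp η * Real.exp (-(η * supNorm (quo L u - y)))) + C * Real.exp (-(η * supNorm (quo L u - y))) :=
        add_le_add ((h _).trans (mul_le_mul_of_nonneg_left hw hC)) (h u)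
    _ = _ := by ring

end Generic

/-! ## §3 The dressed instance: the rate before the length -/

section Three

variable {Lc : ℕ} [NeZero Lc]

/-- NOT IN PRINT; OUR BOOKKEEPING.  **THE COMPOSITE SLOT LEGS OF THE SWAPPED FAMILY — ONE RATE FOR EVERY LENGTH** (as displayed in the module docstring; `d = 3`,
`2 ≤ Lc`): for every `δM > 0` ONE rate `κ₈ > 0` and, for every length `q`, ONE `a₈ ≥ 0` with, for every in-block root, every kernel `M` with `Decays M CM δM` (`0 ≤ CM`),
every level `p` and all `μ y κ v i`: sup `≤ CM·a₈·e^{−κ₈‖quo (Lc^{q+1}) v − y‖∞}` and crude unit gradient `≤ CM·a₈·(e^{κ₈}+1)·e^{−κ₈‖quo (Lc^{q+1}) v − y‖∞}` for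
`legChain (colH ∘ update K♮ᴱ p M) p q`. -/
theorem exists_dressed_slotLeg_bottomKernel_envelopes_rate (hLc : 2 ≤ Lc) {δM : ℝ} (hδM : 0 < δM) :
    ∃ κ₈ : ℝ, 0 < κ₈ ∧ ∀ q : ℕ, ∃ a₈ : ℝ, 0 ≤ a₈ ∧ ∀ (rr : Fin (3 + 1) → ℕ), rr ∈ box (3 + 1) Lc →
      ∀ (M : MKer (3 + 1) (Fib 3)) (CM : ℝ), 0 ≤ CM → Decays M CM δM → ∀ (p : ℕ) (μ : Fin (3 + 1)) (y : Site (3 + 1)) (κ : Fin (3 + 1)) (v : Site (3 + 1)),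
        |legChain (fun j => colH (Function.update (fun j => unitK (sfStep Lc j) (smStep 3 Lc j) (coDressKBmAt (toSite rr) Lc (KInvStep (d := 3) Lc j))) p M j) Lc) p q μ y κ v|
            ≤ CM * a₈ * Real.exp (-(κ₈ * supNorm (quo (Lc ^ (q + 1)) v - y))) ∧
        ∀ i : Fin (3 + 1),
          |legChain (fun j => colH (Function.update (fun j => unitK (sfStep Lc j) (smStep 3 Lc j) (coDressKBmAt (toSite rr) Lc (KInvStep (d := 3) Lc j))) p M j) Lc) p q
                μ y κ (v + Pi.single i 1)
            - legChain (fun j => colH (Function.update (fun j => unitK (sfStep Lc j) (smStep 3 Lc j) (coDressKBmAt (toSite rr) Lc (KInvStep (d := 3) Lc j))) p M j) Lc) p q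
                μ y κ v|
            ≤ CM * a₈ * (Real.exp κ₈ + 1) * Real.exp (-(κ₈ * supNorm (quo (Lc ^ (q + 1)) v - y))) := by
  classical
  have hLc1 : 1 ≤ Lc := le_trans (by norm_num) hLc
  have hL1 : (1 : ℝ) ≤ Lc := by exact_mod_cast hLc1
  -- the natural family's root-uniform rows (part 7) and the natural composite slot legs' envelopes (part 5)
  obtain ⟨C, cK, θ, δK, hδK, -, -, hC, -, hrows⟩ := exists_dressedStep_rows (Lc := Lc) hLc
  obtain ⟨κb, Cr, Cr', Cφ, hκb, hCr, hCr', hCφ, hENV⟩ := exists_dressed_slotLeg_envelopes (Lc := Lc) hLc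
  set κ₈ : ℝ := min κb (δM / 2) with hκ₈
  have hκ₈0 : 0 < κ₈ := lt_min hκb (by linarith)
  have hκ₈M : κ₈ ≤ δM := (min_le_right _ _).trans (by linarith)
  refine ⟨κ₈, hκ₈0, fun q => ?_⟩
  cases q with
  | zero =>
    -- the length-one leg: `colH M` alone, at rate `δM ≥ κ₈`
    refine ⟨1, zero_le_one, ?_⟩
    intro rr hrr M CM hCM hM p μ y κ v
    have hsup : ∀ v, |legChain (fun j => colH (Function.update (fun j => unitK (sfStep Lc j) (smStep 3 Lc j)
          (coDressKBmAt (toSite rr) Lc (KInvStep (d := 3) Lc j))) p M j) Lc) p 0 μ y κ v|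
        ≤ CM * 1 * Real.exp (-(κ₈ * supNorm (quo (Lc ^ (0 + 1)) v - y))) := by
      intro v
      rw [legChain_zero, Function.update_self, mul_one, zero_add, pow_one]
      have h := abs_le_env_of_legDecay (d := 3) hLc1 (legDecay_colH (N := Lc) hM) hδM.le μ y κ v
      refine h.trans (mul_le_mul_of_nonneg_left (Real.exp_le_exp.2 ?_) hCM)
      have := supNorm_nonneg (quo Lc v - y); nlinarith
    refine ⟨hsup v, fun i => ?_⟩
    have hq1 : 1 ≤ Lc ^ (0 + 1) := Nat.one_le_pow _ _ hLc1
    exact abs_sub_le_of_env (d := 3) hq1 (R := fun v => legChain (fun j => colH (Function.update (fun j => unitK (sfStep Lc j) (smStep 3 Lc j)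
      (coDressKBmAt (toSite rr) Lc (KInvStep (d := 3) Lc j))) p M j) Lc) p 0 μ y κ v) (by positivity) hκ₈0.le y hsup v i
  | succ k =>
    -- length ≥ 2: the natural composite slot leg above, `colH M` below
    set A : ℝ := Cr + Cφ * (Real.exp κb + 1) with hA
    have hA0 : 0 ≤ A := by rw [hA]; positivity
    set a₈ : ℝ := ((3 + 1 : ℕ) : ℝ) * A * Zl (3 + 1) (δM / 2) with ha₈
    have hZ := Zl_nonneg (D := 3 + 1) (show 0 < δM / 2 by linarith)
    have ha₈0 : 0 ≤ a₈ := by rw [ha₈]; positivity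
    refine ⟨a₈, ha₈0, ?_⟩
    intro rr hrr M CM hCM hM p μ y κ v
    have hq1 : 1 ≤ Lc ^ (k + 1 + 1) := Nat.one_le_pow _ _ hLc1
    -- the upper chain's envelope at rate `κb`, powers of `Lc` dropped
    obtain ⟨hr0, -, hφ0⟩ := hENV rr hrr (p + 1) k
    have hE := legChain_dressed_colH_eq (d := 3) hrr (p + 1) k
    have hU : ∀ (μ : Fin (3 + 1)) (y : Site (3 + 1)) (lam : Fin (3 + 1)) (v : Site (3 + 1)),
        |legChain (fun j => colH (unitK (sfStep Lc j) (smStep 3 Lc j) (coDressKBmAt (toSite rr) Lc (KInvStep (d := 3) Lc j))) Lc) (p + 1) k μ y lam v|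
          ≤ A * Real.exp (-(κb * supNorm (quo (Lc ^ (k + 1)) v - y))) := by
      intro μ y lam v
      rw [hE]
      have hk1 : 1 ≤ Lc ^ (k + 1) := Nat.one_le_pow _ _ hLc1
      have hp5 : ((Lc : ℝ) ^ (5 * (k + 1)))⁻¹ ≤ 1 := inv_le_one_of_one_le₀ (one_le_pow₀ hL1)
      have hp4 : ((Lc : ℝ) ^ (4 * (k + 1)))⁻¹ ≤ 1 := inv_le_one_of_one_le₀ (one_le_pow₀ hL1)
      have hE0 : 0 ≤ Real.exp (-(κb * supNorm (quo (Lc ^ (k + 1)) v - y))) := (Real.exp_pos _).le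
      have h1 : |respStep (d := 3) (Lc ^ (p + 1)) (Lc ^ (p + 1 + k + 1)) μ y lam v| ≤ Cr * Real.exp (-(κb * supNorm (quo (Lc ^ (k + 1)) v - y))) := by
        refine (hr0 μ y lam v).trans ?_
        have : Cr * ((Lc : ℝ) ^ (5 * (k + 1)))⁻¹ ≤ Cr := mul_le_of_le_one_right hCr hp5
        exact mul_le_mul_of_nonneg_right this hE0
      have h2 : ∀ w, |Psi (toSite rr) Lc (p + 1) k (fun μ' y' => if μ' = μ then (if y' = y then (1 : ℝ) else 0) else 0) w
            - bmGaugeAt (toSite rr) (legAct (respStep (d := 3) (Lc ^ (p + 1)) (Lc ^ (p + 1 + k + 1)))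
                (fun μ' y' => if μ' = μ then (if y' = y then (1 : ℝ) else 0) else 0)) Lc w|
          ≤ Cφ * Real.exp (-(κb * supNorm (quo (Lc ^ (k + 1)) w - y))) := by
        intro w
        refine (hφ0 μ y w).trans ?_
        have : Cφ * ((Lc : ℝ) ^ (4 * (k + 1)))⁻¹ ≤ Cφ := mul_le_of_le_one_right hCφ hp4
        exact mul_le_mul_of_nonneg_right this (Real.exp_pos _).le
      -- the shifted potential: block label within one
      have hl1 : l1 (v + unitVec lam - v) = 1 := by
        rw [add_sub_cancel_left]
        unfold l1
        rw [Finset.sum_eq_single lam (fun j _ hj => by simp [B6BondElimination.unitVec_apply, hj]) (fun hh => (hh (Finset.mem_univ lam)).elim)]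
        simp [B6BondElimination.unitVec_apply]
      have hw := env_wobble (d := 3) hk1 hκb.le y v (v + unitVec lam)
      rw [hl1, mul_one] at hw
      have h3 := (h2 (v + unitVec lam)).trans (mul_le_mul_of_nonneg_left hw hCφ)
      have h4 := h2 v
      calc _ ≤ |respStep (d := 3) (Lc ^ (p + 1)) (Lc ^ (p + 1 + k + 1)) μ y lam v|
            + |(Psi (toSite rr) Lc (p + 1) k (fun μ' y' => if μ' = μ then (if y' = y then (1 : ℝ) else 0) else 0) (v + unitVec lam)
                - bmGaugeAt (toSite rr) (legAct (respStep (d := 3) (Lc ^ (p + 1)) (Lc ^ (p + 1 + k + 1)))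
                    (fun μ' y' => if μ' = μ then (if y' = y then (1 : ℝ) else 0) else 0)) Lc (v + unitVec lam))
              - (Psi (toSite rr) Lc (p + 1) k (fun μ' y' => if μ' = μ then (if y' = y then (1 : ℝ) else 0) else 0) v
                - bmGaugeAt (toSite rr) (legAct (respStep (d := 3) (Lc ^ (p + 1)) (Lc ^ (p + 1 + k + 1)))
                    (fun μ' y' => if μ' = μ then (if y' = y then (1 : ℝ) else 0) else 0)) Lc v)| := abs_add_le _ _
        _ ≤ Cr * Real.exp (-(κb * supNorm (quo (Lc ^ (k + 1)) v - y)))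
            + (Cφ * (Real.exp κb * Real.exp (-(κb * supNorm (quo (Lc ^ (k + 1)) v - y)))) + Cφ * Real.exp (-(κb * supNorm (quo (Lc ^ (k + 1)) v - y)))) :=
            add_le_add h1 ((abs_sub _ _).trans (add_le_add h3 h4))
        _ = A * Real.exp (-(κb * supNorm (quo (Lc ^ (k + 1)) v - y))) := by rw [hA]; ring
    -- the swapped family unrolls at its fine end: `colH M` below the natural chain
    have hdec : ∀ j, ∃ C' m' : ℝ, 0 < m' ∧ LegDecay ((fun j => colH (Function.update (fun j => unitK (sfStep Lc j) (smStep 3 Lc j)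
          (coDressKBmAt (toSite rr) Lc (KInvStep (d := 3) Lc j))) p M j) Lc) j) Lc C' m' :=
      fun j => ⟨max C CM, min δK δM, lt_min hδK hδM, legDecay_colH_update (hrows rr hrr).1 hM hC p j⟩
    have hcongr : legChain (fun j => colH (Function.update (fun j => unitK (sfStep Lc j) (smStep 3 Lc j)
          (coDressKBmAt (toSite rr) Lc (KInvStep (d := 3) Lc j))) p M j) Lc) (p + 1) k
        = legChain (fun j => colH (unitK (sfStep Lc j) (smStep 3 Lc j) (coDressKBmAt (toSite rr) Lc (KInvStep (d := 3) Lc j))) Lc) (p + 1) k :=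
      legChain_congr_from (fun j hj => by rw [Function.update_of_ne (show j ≠ p by omega)]) k
    have hunroll : legChain (fun j => colH (Function.update (fun j => unitK (sfStep Lc j) (smStep 3 Lc j)
          (coDressKBmAt (toSite rr) Lc (KInvStep (d := 3) Lc j))) p M j) Lc) p (k + 1)
        = legComp (colH M Lc) (legChain (fun j => colH (unitK (sfStep Lc j) (smStep 3 Lc j) (coDressKBmAt (toSite rr) Lc (KInvStep (d := 3) Lc j))) Lc) (p + 1) k) := by
      rw [legChain_succ_left hLc1 hdec p k, hcongr]
      simp only [Function.update_self]
    -- the sup envelope (§2) and the crude gradient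
    have hsup : ∀ v, |legChain (fun j => colH (Function.update (fun j => unitK (sfStep Lc j) (smStep 3 Lc j)
          (coDressKBmAt (toSite rr) Lc (KInvStep (d := 3) Lc j))) p M j) Lc) p (k + 1) μ y κ v|
        ≤ CM * a₈ * Real.exp (-(κ₈ * supNorm (quo (Lc ^ (k + 1 + 1)) v - y))) := by
      intro v
      rw [hunroll]
      have h := abs_legComp_colH_le (d := 3) hLc1 k hA0 hκb.le hU hCM hδM hM μ y κ v
      rw [show k + 1 + 1 = k + 2 by ring, hκ₈]
      refine h.trans (le_of_eq ?_)
      rw [ha₈]; ring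
    exact ⟨hsup v, fun i => abs_sub_le_of_env (d := 3) hq1 (R := fun v => legChain (fun j => colH (Function.update (fun j => unitK (sfStep Lc j) (smStep 3 Lc j)
      (coDressKBmAt (toSite rr) Lc (KInvStep (d := 3) Lc j))) p M j) Lc) p (k + 1) μ y κ v) (by positivity) hκ₈0.le y hsup v i⟩

end Three

end Summit.QuantumFields.BalabanUV.Beta.GAN24.CarrierSlotLegBottomKernelRate

end
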